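import Literature.Analysis.FluidPDE.NSRegFourierMollifier
import Literature.Analysis.FluidPDE.MollifiedField
import HarnessLib

/-!
# The Fourier datum of the Leray-regularised problem from an `L²` divergence-free field

Analysis/FluidPDE file serving the discharge of
`Literature.Analysis.FluidPDE.leray_regularised_wellposed` (Leray 1934, Ch. V §§26–27;
Ożański–Pooley 2018, Thm. 6.33 / Lemma 6.34). The Fourier-side construction of the global regular
solution of the Leray-regularised Navier–Stokes system (`NSRegFourier*`, datum hypotheses
`FourierNS.GlobalHyp c m K a` of `NSRegFourierGlobal`: a measurable coefficient field in every
weighted `L²`, transversal and conjugation symmetric **at every frequency**) is fed here with the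
datum of the fact: the mollification `J_χ u₀` of an arbitrary weakly divergence-free
`u₀ ∈ L²(E; E)` (Leray 1934, §26: the initial state of the regularised system is
`\overline{U(x,0)}`; Ożański–Pooley 2018, proof of Thm. 6.37: `u_ε(0) = J_ε u₀`).

* `fourier_msymbol_mul_Lp` — **`𝓕 (m · g) = θ ⋆ 𝓕 g` on `L²`**: for `g ∈ L²(E; ℂ)`,
  `𝓕 (m g)(x) = ∫ θ(x − y) (𝓕 g)(y) dy` with Mathlib's `L²` (Plancherel) Fourier transform
  `MeasureTheory.Lp.fourierTransformₗᵢ` on the right (`m = 𝓕θ` the multiplier of the bump kernel,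
  `NSRegFourierMollifier`); both sides are continuous linear functionals on `L²` agreeing on the
  dense Schwartz functions (`fourier_msymbol_mul`, `SchwartzMap.toLp_fourier_eq`,
  `SchwartzMap.denseRange_toLpCLM`).
* `fourier_msymbol_mul_fourierInv` — hence `𝓕 (m · 𝓕⁻u₀ₗ)(x) = (J_χ u₀)(x)ₗ` for `u₀ ∈ L²`.
* `symRep_neg`, `sum_mul_projC`, … — the pointwise conjugation-symmetrisation
  `gˢ(ξ) = ½(g(ξ) + conj g(−ξ))` and the pointwise Leray projection `P_ξ c = c − (ξ·c/|ξ|²) ξ` of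
  coefficient vectors (null modifications making conjugation symmetry and transversality hold at
  every frequency; used through defining hypotheses `hS`, `hP`, no auxiliary definitions).
* `ae_transversal_of_isDivFree` — **transversality a.e. from incompressibility**: if the real
  synthesis `Re 𝓕 b` of a conjugation-symmetric coefficient with integrable moments is divergence
  free, then `Σ ξₗ bₗ(ξ) = 0` a.e. (the divergence symbol `Σ −2πi ξₗ bₗ ∈ L¹ ∩ L²` has vanishing
  real synthesis, hence vanishes in `L²` by Plancherel, `NSFourierPlancherel`).
* `exists_fourierDatum` — **the datum**: for `u₀ ∈ L²` weakly divergence free, `χ` a bump kernel,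
  `c > 0` and `2K > card ι` there is `a` with `GlobalHyp c (msymbol χ) K a`, `wfun K' a ∈ L²` for
  every `K'`, and `𝓕 aₗ(x) = (J_χ u₀)(x)ₗ` for all `x`, `l` (`a = P_ξ (m (𝓕⁻u₀)ˢ)`; the
  divergence of `J_χ u₀` vanishes by `MollifiedField.divergence_convolution_eq_zero`).

## Mathlib / tree search

Mathlib (this pin) has the `L²` Fourier transform as a linear isometry equivalence
(`MeasureTheory.Lp.fourierTransformₗᵢ`, `SchwartzMap.toLp_fourier_eq`, density
`SchwartzMap.denseRange_toLpCLM`) but no multiplier/convolution identity on `L²`; the tree has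
Plancherel for `L¹ ∩ L²` functions (`NSFourierPlancherel`), the multiplier of a bump kernel and
`𝓕 (m f) = θ ⋆ 𝓕 f` for `f ∈ L¹` (`NSRegFourierMollifier`), and `div (ρ ⋆ w) = 0` for weakly
divergence-free `w` (`MollifiedField`). Searched `fourierTransformₗᵢ`, `Lp.fourier`, `transversal`,
`leraySymbol` (`TaoAveragedEuler.leraySymbolC` acts on `EuclideanSpace ℂ ι`, not on `ι → ℂ`).

## References

* J. Leray, *Sur le mouvement d'un liquide visqueux emplissant l'espace*, Acta Math. 63 (1934),
  §8 (p. 206, `\overline{U}`), Ch. V §26 (pp. 231–232, system (5.1) and its initial state). [Leray1934]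
* W. S. Ożański, B. C. Pooley, *Leray's fundamental work on the Navier–Stokes equations: a modern
  review*, LMS Lecture Note Ser. 452 (2018) = arXiv:1708.09787, Thm. 6.33, (6.77), (6.91). [OzanskiPooley2018]
* E. M. Stein, G. Weiss, *Introduction to Fourier Analysis on Euclidean Spaces* (1971), Ch. I,
  Thm. 2.3 (Plancherel) and §1 (multipliers of `L¹` kernels).
-/

noncomputable section

open MeasureTheory Real Set Filter Topology Function Complex FourierTransform SchwartzMap InnerProductSpace
open scoped FourierTransform RealInnerProductSpace ENNReal ContDiff ComplexConjugate Convolution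

namespace Literature.Analysis.FluidPDE.FourierNS

open ClayDatum (reVec reVec_apply)

variable {ι : Type*} [Fintype ι]

variable (χ : ContDiffBump (0 : EuclideanSpace ℝ ι))

/-! ### The multiplier and the kernel in `L²` -/

/-- The complexified multiplier `m = 𝓕θ` is square integrable. [folklore] -/
theorem memLp_msymbol : MemLp (fun ξ => (msymbol χ ξ : ℂ)) 2 (volume : Measure (EuclideanSpace ℝ ι)) := by
  classical
  have h := (isMollifierSymbol_msymbol χ).eLpNorm_wfun_lt_top 0
  rw [wfun_zero] at h
  exact ⟨(isMollifierSymbol_msymbol χ).measurable_ofReal.aestronglyMeasurable, h⟩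

/-- The Fourier kernel against the multiplier at the point `x`:
`k_x(ξ) = conj (e^{-2πi⟪ξ,x⟫} m(ξ))`, square integrable. [folklore] -/
theorem memLp_fourierKernel_msymbol (x : EuclideanSpace ℝ ι) :
    MemLp (fun ξ : EuclideanSpace ℝ ι => conj (((𝐞 (-⟪ξ, x⟫) : Circle) : ℂ) * (msymbol χ ξ : ℂ))) 2 volume := by
  refine (memLp_msymbol χ).norm.mono' ?_ (Eventually.of_forall fun ξ => ?_)
  · exact ((by fun_prop : Continuous fun ξ : EuclideanSpace ℝ ι => ((𝐞 (-⟪ξ, x⟫) : Circle) : ℂ)).mul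
      (Complex.continuous_ofReal.comp (continuous_msymbol χ))).aestronglyMeasurable.star
  · rw [Complex.norm_conj, norm_mul, Circle.norm_coe, one_mul]

/-- The reflected kernel `y ↦ θ(x − y)` has compact support. [folklore] -/
theorem hasCompactSupport_bumpC_comp_sub (x : EuclideanSpace ℝ ι) :
    HasCompactSupport fun y : EuclideanSpace ℝ ι => bumpC χ (x - y) := by
  have h := (hasCompactSupport_bumpC χ).comp_homeomorph
    ((Homeomorph.neg (EuclideanSpace ℝ ι)).trans (Homeomorph.addLeft x))
  have heq : (fun y : EuclideanSpace ℝ ι => bumpC χ (x - y)) =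
      bumpC χ ∘ ⇑((Homeomorph.neg (EuclideanSpace ℝ ι)).trans (Homeomorph.addLeft x)) := by
    funext y
    simp [sub_eq_add_neg]
  rw [heq]
  exact h

/-- The reflected kernel `y ↦ θ(x − y)` is continuous with compact support, hence in `L²`. [folklore] -/
theorem memLp_bumpC_comp_sub (x : EuclideanSpace ℝ ι) :
    MemLp (fun y : EuclideanSpace ℝ ι => bumpC χ (x - y)) 2 volume :=
  ((continuous_bumpC χ).comp (continuous_const.sub continuous_id)).memLp_of_hasCompactSupport
    (hasCompactSupport_bumpC_comp_sub χ x)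

/-- The kernel is real: `conj θ = θ`. [folklore] -/
theorem conj_bumpC (z : EuclideanSpace ℝ ι) : conj (bumpC χ z) = bumpC χ z := by
  rw [bumpC, Complex.conj_ofReal]

/-! ### The `L²` multiplier–convolution identity -/

/-- **`𝓕 (m · g) = θ ⋆ 𝓕 g` on `L²`** (`m = 𝓕θ`): for `g ∈ L²(E; ℂ)` and every `x`,
`𝓕 (m · g)(x) = ∫ θ(x − y) (𝓕 g)(y) dy`, where `𝓕 g` is the `L²` (Plancherel) Fourier transform
of Mathlib (`MeasureTheory.Lp.fourierTransformₗᵢ`) and the left-hand side is the Fourier integral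
of the integrable function `m · g`. Both sides are continuous linear functionals of `g ∈ L²`
(`L²` inner products against `conj (e^{-2πi⟪·,x⟫} m)` and, through the `L²` isometry `𝓕`, against
`θ(x − ·)`), and they agree on Schwartz functions (`fourier_msymbol_mul`, Fubini), which are
dense. [folklore] -/
theorem fourier_msymbol_mul_Lp (g : Lp ℂ 2 (volume : Measure (EuclideanSpace ℝ ι))) (x : EuclideanSpace ℝ ι) :
    𝓕 (fun ξ => (msymbol χ ξ : ℂ) * (g : EuclideanSpace ℝ ι → ℂ) ξ) x =
      ∫ y, bumpC χ (x - y) * ((𝓕 g : Lp ℂ 2 (volume : Measure (EuclideanSpace ℝ ι))) : EuclideanSpace ℝ ι → ℂ) y := by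
  -- the two functionals as `L²` inner products
  set kx : Lp ℂ 2 (volume : Measure (EuclideanSpace ℝ ι)) := (memLp_fourierKernel_msymbol χ x).toLp _ with hkx
  set rx : Lp ℂ 2 (volume : Measure (EuclideanSpace ℝ ι)) := (memLp_bumpC_comp_sub χ x).toLp _ with hrx
  have hL : ∀ g : Lp ℂ 2 (volume : Measure (EuclideanSpace ℝ ι)),
      𝓕 (fun ξ => (msymbol χ ξ : ℂ) * (g : EuclideanSpace ℝ ι → ℂ) ξ) x = ⟪kx, g⟫_ℂ := by
    intro g
    rw [MeasureTheory.L2.inner_def, Real.fourier_eq]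
    refine integral_congr_ae ?_
    filter_upwards [(memLp_fourierKernel_msymbol χ x).coeFn_toLp] with ξ hξ
    rw [hξ, RCLike.inner_apply, starRingEnd_self_apply]
    simp only [Circle.smul_def, smul_eq_mul]
    ring
  have hR : ∀ g : Lp ℂ 2 (volume : Measure (EuclideanSpace ℝ ι)),
      (∫ y, bumpC χ (x - y) * ((𝓕 g : Lp ℂ 2 (volume : Measure (EuclideanSpace ℝ ι))) : EuclideanSpace ℝ ι → ℂ) y) =
        ⟪rx, (𝓕 g : Lp ℂ 2 (volume : Measure (EuclideanSpace ℝ ι)))⟫_ℂ := by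
    intro g
    rw [MeasureTheory.L2.inner_def]
    refine integral_congr_ae ?_
    filter_upwards [(memLp_bumpC_comp_sub χ x).coeFn_toLp] with y hy
    rw [hy, RCLike.inner_apply, conj_bumpC, mul_comm]
  -- density of Schwartz functions
  have hclosed : IsClosed {g : Lp ℂ 2 (volume : Measure (EuclideanSpace ℝ ι)) |
      𝓕 (fun ξ => (msymbol χ ξ : ℂ) * (g : EuclideanSpace ℝ ι → ℂ) ξ) x =
        ∫ y, bumpC χ (x - y) * ((𝓕 g : Lp ℂ 2 (volume : Measure (EuclideanSpace ℝ ι))) : EuclideanSpace ℝ ι → ℂ) y} := by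
    have h1 : Continuous fun g : Lp ℂ 2 (volume : Measure (EuclideanSpace ℝ ι)) => ⟪kx, g⟫_ℂ :=
      continuous_const.inner continuous_id
    have h2 : Continuous fun g : Lp ℂ 2 (volume : Measure (EuclideanSpace ℝ ι)) =>
        ⟪rx, (𝓕 g : Lp ℂ 2 (volume : Measure (EuclideanSpace ℝ ι)))⟫_ℂ :=
      continuous_const.inner continuous_fourier
    simp_rw [hL, hR]
    exact isClosed_eq h1 h2
  refine DenseRange.induction_on (p := fun g : Lp ℂ 2 (volume : Measure (EuclideanSpace ℝ ι)) =>
      𝓕 (fun ξ => (msymbol χ ξ : ℂ) * (g : EuclideanSpace ℝ ι → ℂ) ξ) x =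
        ∫ y, bumpC χ (x - y) * ((𝓕 g : Lp ℂ 2 (volume : Measure (EuclideanSpace ℝ ι))) : EuclideanSpace ℝ ι → ℂ) y)
    (SchwartzMap.denseRange_toLpCLM (F := ℂ) (μ := (volume : Measure (EuclideanSpace ℝ ι))) (p := 2)
      ENNReal.ofNat_ne_top) g hclosed fun φ => ?_
  -- Schwartz functions: `fourier_msymbol_mul` and Mathlib's `SchwartzMap.toLp_fourier_eq`
  show 𝓕 (fun ξ => (msymbol χ ξ : ℂ) * ((φ.toLp 2 volume : Lp ℂ 2 (volume : Measure (EuclideanSpace ℝ ι))) :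
      EuclideanSpace ℝ ι → ℂ) ξ) x =
    ∫ y, bumpC χ (x - y) * ((𝓕 (φ.toLp 2 volume) : Lp ℂ 2 (volume : Measure (EuclideanSpace ℝ ι))) :
      EuclideanSpace ℝ ι → ℂ) y
  have hφ : ((φ.toLp 2 volume : Lp ℂ 2 (volume : Measure (EuclideanSpace ℝ ι))) : EuclideanSpace ℝ ι → ℂ) =ᵐ[volume] φ :=
    φ.coeFn_toLp 2 volume
  have hF : ((𝓕 (φ.toLp 2 volume) : Lp ℂ 2 (volume : Measure (EuclideanSpace ℝ ι))) : EuclideanSpace ℝ ι → ℂ) =ᵐ[volume]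
      𝓕 (φ : EuclideanSpace ℝ ι → ℂ) := by
    rw [SchwartzMap.toLp_fourier_eq]
    filter_upwards [(𝓕 φ).coeFn_toLp 2 volume] with y hy
    rw [hy, SchwartzMap.fourier_coe]
  have h1 : 𝓕 (fun ξ => (msymbol χ ξ : ℂ) * ((φ.toLp 2 volume : Lp ℂ 2 (volume : Measure (EuclideanSpace ℝ ι))) :
      EuclideanSpace ℝ ι → ℂ) ξ) x = 𝓕 (fun ξ => (msymbol χ ξ : ℂ) * φ ξ) x := by
    refine Real.fourier_congr_ae ?_ x
    filter_upwards [hφ] with ξ hξ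
    rw [hξ]
  rw [h1, fourier_msymbol_mul χ φ.integrable x]
  -- `∫ θ(y) 𝓕φ(x - y) dy = ∫ θ(x - y) 𝓕φ(y) dy`
  have h2 : ∫ y, bumpC χ y * 𝓕 (φ : EuclideanSpace ℝ ι → ℂ) (x - y) =
      ∫ y, bumpC χ (x - y) * 𝓕 (φ : EuclideanSpace ℝ ι → ℂ) y := by
    rw [← integral_sub_left_eq_self _ volume x]
    refine integral_congr_ae (Eventually.of_forall fun y => ?_)
    simp only [sub_sub_cancel]
  rw [h2]
  refine integral_congr_ae ?_
  filter_upwards [hF] with y hy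
  rw [hy]

/-! ### Reflection and conjugation on the Fourier side -/

/-- `𝓕 (conj ∘ b ∘ neg)(x) = conj (𝓕 b (x))` (no integrability needed: both sides are Bochner
integrals transformed by `ξ ↦ -ξ` and `conj`). [folklore] -/
theorem fourier_conj_neg (b : EuclideanSpace ℝ ι → ℂ) (x : EuclideanSpace ℝ ι) :
    𝓕 (fun ξ => conj (b (-ξ))) x = conj (𝓕 b x) := by
  rw [Real.fourier_eq, Real.fourier_eq, ← integral_conj, ← integral_neg_eq_self _ volume]
  refine integral_congr_ae (Eventually.of_forall fun ξ => ?_)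
  simp only [Circle.smul_def, smul_eq_mul, map_mul, inner_neg_left, neg_neg, Circle.starRingEnd_addChar]

/-- `ξ ↦ conj (g (-ξ))` is in `L²` with `g`. [folklore] -/
theorem memLp_conj_neg {g : EuclideanSpace ℝ ι → ℂ} (hg : MemLp g 2 (volume : Measure (EuclideanSpace ℝ ι))) :
    MemLp (fun ξ => conj (g (-ξ))) 2 (volume : Measure (EuclideanSpace ℝ ι)) := by
  have h1 : MemLp (fun ξ => g (-ξ)) 2 (volume : Measure (EuclideanSpace ℝ ι)) :=
    hg.comp_measurePreserving (Measure.measurePreserving_neg (volume : Measure (EuclideanSpace ℝ ι)))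
  refine h1.of_le h1.1.star (Eventually.of_forall fun ξ => ?_)
  rw [Complex.norm_conj]

/-- `ξ ↦ conj (g (-ξ))` is measurable with `g`. [folklore] -/
theorem measurable_conj_neg {g : EuclideanSpace ℝ ι → ℂ} (hg : Measurable g) : Measurable fun ξ => conj (g (-ξ)) :=
  Complex.continuous_conj.measurable.comp (hg.comp measurable_neg)

/-! ### The symmetrised representative and the raw datum

The **conjugation-symmetrisation** of a coefficient `g : E → ℂ` is `gˢ(ξ) = ½ (g(ξ) + conj g(-ξ))`,
so that `gˢ(-ξ) = conj gˢ(ξ)` holds at every point (for `g` the Fourier transform of a real field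
this changes `g` only on a null set). To keep this file free of auxiliary definitions the
operation is a hypothesis `hS : ∀ g ξ, S g ξ = ½ (g ξ + conj (g (-ξ)))` on a map `S` in the lemmas
below (instantiated by the explicit lambda in `exists_fourierDatum`). -/

section Sym

variable {S : (EuclideanSpace ℝ ι → ℂ) → EuclideanSpace ℝ ι → ℂ}

omit [Fintype ι] in
/-- `gˢ(-ξ) = conj gˢ(ξ)`. [folklore] -/
theorem symRep_neg (hS : ∀ g ξ, S g ξ = 2⁻¹ * (g ξ + conj (g (-ξ)))) (g : EuclideanSpace ℝ ι → ℂ) (ξ : EuclideanSpace ℝ ι) :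
    S g (-ξ) = conj (S g ξ) := by
  simp only [hS, neg_neg, map_mul, map_add, Complex.conj_conj, map_inv₀, map_ofNat]
  ring

/-- `gˢ` is measurable. [folklore] -/
theorem measurable_symRep (hS : ∀ g ξ, S g ξ = 2⁻¹ * (g ξ + conj (g (-ξ)))) {g : EuclideanSpace ℝ ι → ℂ}
    (hg : Measurable g) : Measurable (S g) := by
  have : S g = fun ξ => 2⁻¹ * (g ξ + conj (g (-ξ))) := funext (hS g)
  rw [this]
  exact (hg.add (measurable_conj_neg hg)).const_mul _

/-- `gˢ ∈ L²`. [folklore] -/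
theorem memLp_symRep (hS : ∀ g ξ, S g ξ = 2⁻¹ * (g ξ + conj (g (-ξ)))) {g : EuclideanSpace ℝ ι → ℂ}
    (hg : MemLp g 2 (volume : Measure (EuclideanSpace ℝ ι))) :
    MemLp (S g) 2 (volume : Measure (EuclideanSpace ℝ ι)) := by
  have : S g = fun ξ => 2⁻¹ * (g ξ + conj (g (-ξ))) := funext (hS g)
  rw [this]
  exact (hg.add (memLp_conj_neg hg)).const_mul _

/-- **Synthesis of the symmetrised multiplied coefficient**: if `𝓕 (m g)(x)` is real, then
`𝓕 (m gˢ)(x) = 𝓕 (m g)(x)` (`m` real and even). [folklore] -/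
theorem fourier_msymbol_mul_symRep (hS : ∀ g ξ, S g ξ = 2⁻¹ * (g ξ + conj (g (-ξ)))) {g : EuclideanSpace ℝ ι → ℂ}
    (hg : MemLp g 2 (volume : Measure (EuclideanSpace ℝ ι)))
    (x : EuclideanSpace ℝ ι) (hreal : conj (𝓕 (fun ξ => (msymbol χ ξ : ℂ) * g ξ) x) = 𝓕 (fun ξ => (msymbol χ ξ : ℂ) * g ξ) x) :
    𝓕 (fun ξ => (msymbol χ ξ : ℂ) * S g ξ) x = 𝓕 (fun ξ => (msymbol χ ξ : ℂ) * g ξ) x := by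
  have hi1 : Integrable (fun ξ => (msymbol χ ξ : ℂ) * g ξ) volume := (memLp_msymbol χ).integrable_mul hg
  have hi2 : Integrable (fun ξ => (msymbol χ ξ : ℂ) * conj (g (-ξ))) volume :=
    (memLp_msymbol χ).integrable_mul (memLp_conj_neg hg)
  have hsplit : (fun ξ => (msymbol χ ξ : ℂ) * S g ξ) =
      fun ξ => 2⁻¹ * (((fun ξ => (msymbol χ ξ : ℂ) * g ξ) + fun ξ => (msymbol χ ξ : ℂ) * conj (g (-ξ))) ξ) := by
    funext ξ
    simp only [hS, Pi.add_apply]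
    ring
  rw [hsplit, fourier_const_mul', fourier_add' hi1 hi2]
  have hrefl : (fun ξ => (msymbol χ ξ : ℂ) * conj (g (-ξ))) = fun ξ => conj ((msymbol χ (-ξ) : ℂ) * g (-ξ)) := by
    funext ξ
    simp only [map_mul, Complex.conj_ofReal, msymbol_neg]
  have h3 : 𝓕 (fun ξ => conj ((msymbol χ (-ξ) : ℂ) * g (-ξ))) x = conj (𝓕 (fun η => (msymbol χ η : ℂ) * g η) x) :=
    fourier_conj_neg (fun η => (msymbol χ η : ℂ) * g η) x
  rw [hrefl, h3, hreal]
  ring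

end Sym

/-! ### Integrability and weights of a multiplied `L²` coefficient -/

section Weights

variable {G : EuclideanSpace ℝ ι → ι → ℂ}

/-- For `G` with square-integrable components, the components `m Gₗ` are integrable. [folklore] -/
theorem integrable_msymbol_mul (hG : ∀ l, MemLp (fun ξ => G ξ l) 2 (volume : Measure (EuclideanSpace ℝ ι))) (l : ι) :
    Integrable (fun ξ => (msymbol χ ξ : ℂ) * G ξ l) volume :=
  (memLp_msymbol χ).integrable_mul (hG l)

/-- The weighted multiplier `(1 + ‖ξ‖)^K m(ξ)` is square integrable. [folklore] -/
theorem memLp_weight_mul_msymbol (K : ℕ) :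
    MemLp (fun ξ : EuclideanSpace ℝ ι => (((1 + ‖ξ‖) ^ K : ℝ) : ℂ) * (msymbol χ ξ : ℂ)) 2 volume := by
  classical
  have h := (isMollifierSymbol_msymbol χ).eLpNorm_wfun_lt_top K
  refine ⟨(Continuous.aestronglyMeasurable (by fun_prop)).mul
    (Complex.continuous_ofReal.comp (continuous_msymbol χ)).aestronglyMeasurable, ?_⟩
  have heq : (fun ξ : EuclideanSpace ℝ ι => (((1 + ‖ξ‖) ^ K : ℝ) : ℂ) * (msymbol χ ξ : ℂ)) =
      wfun K fun ξ => (msymbol χ ξ : ℂ) := by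
    funext ξ
    rw [wfun_apply, Complex.real_smul]
  rw [heq]
  exact h

/-- First moments of `m Gₗ` are integrable: `‖ξ‖ ‖m(ξ) G(ξ)ₗ‖ ∈ L¹`. [folklore] -/
theorem integrable_norm_mul_msymbol_mul (hG : ∀ l, MemLp (fun ξ => G ξ l) 2 (volume : Measure (EuclideanSpace ℝ ι))) (l : ι) :
    Integrable (fun ξ : EuclideanSpace ℝ ι => ‖ξ‖ * ‖(msymbol χ ξ : ℂ) * G ξ l‖) volume := by
  have h := (memLp_weight_mul_msymbol χ 1).integrable_mul (hG l)
  refine h.norm.mono' ((continuous_norm.aestronglyMeasurable).mul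
    ((integrable_msymbol_mul χ hG l).1.norm)) (Eventually.of_forall fun ξ => ?_)
  rw [Real.norm_of_nonneg (by positivity), Pi.mul_apply]
  simp only [norm_mul, Complex.norm_real]
  rw [Real.norm_of_nonneg (by positivity : (0 : ℝ) ≤ (1 + ‖ξ‖) ^ 1), pow_one]
  have : ‖ξ‖ ≤ 1 + ‖ξ‖ := by linarith [norm_nonneg ξ]
  calc ‖ξ‖ * (‖msymbol χ ξ‖ * ‖G ξ l‖) ≤ (1 + ‖ξ‖) * (‖msymbol χ ξ‖ * ‖G ξ l‖) := by gcongr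
    _ = (1 + ‖ξ‖) * ‖msymbol χ ξ‖ * ‖G ξ l‖ := by ring

/-- Coordinate-weighted components are square integrable: `ξⱼ m(ξ) G(ξ)ₗ ∈ L²`. [folklore] -/
theorem memLp_coord_mul_msymbol_mul (hG : ∀ l, MemLp (fun ξ => G ξ l) 2 (volume : Measure (EuclideanSpace ℝ ι)))
    (hGm : Measurable G) (j l : ι) :
    MemLp (fun ξ : EuclideanSpace ℝ ι => ((ξ j : ℝ) : ℂ) * ((msymbol χ ξ : ℂ) * G ξ l)) 2 volume := by
  obtain ⟨M, hM⟩ := msymbol_decay χ 1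
  have hM0 : 0 ≤ M := le_trans (by positivity) (hM 0)
  refine ((hG l).const_mul (M : ℂ)).of_le ?_ (Eventually.of_forall fun ξ => ?_)
  · exact ((Complex.continuous_ofReal.comp (by fun_prop : Continuous fun ξ : EuclideanSpace ℝ ι => ξ j)).measurable.mul
      ((continuous_msymbol χ).measurable.complex_ofReal.mul (measurable_pi_iff.1 hGm l))).aestronglyMeasurable
  · simp only [norm_mul, Complex.norm_real, Real.norm_eq_abs, abs_of_nonneg hM0]
    have h1 : |ξ j| * |msymbol χ ξ| ≤ M := by
      calc |ξ j| * |msymbol χ ξ| ≤ (1 + ‖ξ‖) ^ 1 * |msymbol χ ξ| := by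
            rw [pow_one]
            exact mul_le_mul_of_nonneg_right ((abs_apply_le_norm ξ j).trans (by linarith [norm_nonneg ξ])) (abs_nonneg _)
        _ ≤ M := hM ξ
    calc |ξ j| * (|msymbol χ ξ| * ‖G ξ l‖) = (|ξ j| * |msymbol χ ξ|) * ‖G ξ l‖ := by ring
      _ ≤ M * ‖G ξ l‖ := mul_le_mul_of_nonneg_right h1 (norm_nonneg _)

/-- **Every weighted `L²` norm of `m G` is finite**: `‖wfun K (m G)‖_{L²} < ∞`
(`(1+‖ξ‖)^K |m| ≤ M_K`). [folklore] -/
theorem eLpNorm_wfun_msymbol_mul_lt_top (hG : ∀ l, MemLp (fun ξ => G ξ l) 2 (volume : Measure (EuclideanSpace ℝ ι)))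
    (hGm : Measurable G) (K : ℕ) :
    eLpNorm (wfun K fun ξ l => (msymbol χ ξ : ℂ) * G ξ l) 2 (volume : Measure (EuclideanSpace ℝ ι)) < ⊤ := by
  obtain ⟨M, hM⟩ := msymbol_decay χ K
  have hM0 : 0 ≤ M := le_trans (by positivity) (hM 0)
  -- dominating function `M Σₗ ‖Gₗ‖`
  have hsum : MemLp (fun ξ => ∑ l, ‖G ξ l‖) 2 (volume : Measure (EuclideanSpace ℝ ι)) :=
    memLp_finsetSum Finset.univ fun l _ => (hG l).norm
  have hdom : MemLp (fun ξ => M * ∑ l, ‖G ξ l‖) 2 (volume : Measure (EuclideanSpace ℝ ι)) := hsum.const_mul M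
  have hmeas : AEStronglyMeasurable (wfun K fun ξ l => (msymbol χ ξ : ℂ) * G ξ l) (volume : Measure (EuclideanSpace ℝ ι)) :=
    aestronglyMeasurable_wfun K (measurable_pi_iff.2 fun l =>
      (continuous_msymbol χ).measurable.complex_ofReal.mul (measurable_pi_iff.1 hGm l)).aestronglyMeasurable
  refine (hdom.of_le hmeas (Eventually.of_forall fun ξ => ?_)).eLpNorm_lt_top
  rw [norm_wfun, Real.norm_of_nonneg (mul_nonneg hM0 (Finset.sum_nonneg fun l _ => norm_nonneg _))]
  -- `‖(m G)(ξ)‖ ≤ |m ξ| Σₗ ‖Gₗ ξ‖`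
  have hpi : ‖(fun l => (msymbol χ ξ : ℂ) * G ξ l)‖ ≤ |msymbol χ ξ| * ∑ l, ‖G ξ l‖ := by
    refine (pi_norm_le_iff_of_nonneg (by positivity)).2 fun l => ?_
    rw [norm_mul, Complex.norm_real, Real.norm_eq_abs]
    exact mul_le_mul_of_nonneg_left (Finset.single_le_sum (fun k _ => norm_nonneg (G ξ k)) (Finset.mem_univ l))
      (abs_nonneg _)
  calc (1 + ‖ξ‖) ^ K * ‖(fun l => (msymbol χ ξ : ℂ) * G ξ l)‖ ≤ (1 + ‖ξ‖) ^ K * (|msymbol χ ξ| * ∑ l, ‖G ξ l‖) :=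
        mul_le_mul_of_nonneg_left hpi (by positivity)
    _ = ((1 + ‖ξ‖) ^ K * |msymbol χ ξ|) * ∑ l, ‖G ξ l‖ := by ring
    _ ≤ M * ∑ l, ‖G ξ l‖ := mul_le_mul_of_nonneg_right (hM ξ) (Finset.sum_nonneg fun l _ => norm_nonneg _)

end Weights

/-! ### The divergence of a synthesis, and transversality almost everywhere -/

section Transversal

variable {b : EuclideanSpace ℝ ι → ι → ℂ}

/-- **The divergence of a Fourier synthesis**: for coefficients with integrable components and
first moments, `div (Re 𝓕 b)(x) = Re 𝓕 (Σₗ -2πi ξₗ bₗ)(x)`. [folklore] -/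
theorem divergence_reVec_fourier [DecidableEq ι] (hb : ∀ l, Integrable (fun ξ => b ξ l) volume)
    (hb1 : ∀ l, Integrable (fun ξ : EuclideanSpace ℝ ι => ‖ξ‖ * ‖b ξ l‖) volume) (x : EuclideanSpace ℝ ι) :
    VectorCalculus.divergence (fun x => reVec fun l => 𝓕 (fun ξ => b ξ l) x) x =
      (𝓕 (fun ξ => ∑ l, (-(2 * π * I) * ((ξ l : ℝ) : ℂ)) * b ξ l) x).re := by
  set U : EuclideanSpace ℝ ι → ι → ℂ := fun x l => 𝓕 (fun ξ => b ξ l) x with hU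
  have hdiff : ∀ l, Differentiable ℝ fun x => U x l := fun l =>
    Real.differentiable_fourier (hb l) (by simpa using hb1 l)
  have hfd : ∀ x h l, fderiv ℝ (fun x => U x l) x h = 𝓕 (fun ξ => (-(2 * π * I) * (⟪ξ, h⟫ : ℂ)) * b ξ l) x :=
    fun x h l => fderiv_fourier_apply_mom (hb l) (by simpa using hb1 l) x h
  have hcomp : (fun x => reVec fun l => 𝓕 (fun ξ => b ξ l) x) = reVec ∘ U := rfl
  have hUd : ∀ x, DifferentiableAt ℝ U x := fun x => differentiableAt_pi.2 fun l => hdiff l x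
  have hfderiv : ∀ h l, fderiv ℝ (fun x => reVec fun l => 𝓕 (fun ξ => b ξ l) x) x h l =
      (𝓕 (fun ξ => (-(2 * π * I) * (⟪ξ, h⟫ : ℂ)) * b ξ l) x).re := by
    intro h l
    have h1 : HasFDerivAt (fun x => reVec fun l => 𝓕 (fun ξ => b ξ l) x) ((reVec (ι := ι)).comp (fderiv ℝ U x)) x := by
      rw [hcomp]
      exact (reVec (ι := ι)).hasFDerivAt.comp x (hUd x).hasFDerivAt
    rw [h1.fderiv, ContinuousLinearMap.comp_apply, reVec_apply]
    have h2 : fderiv ℝ U x = ContinuousLinearMap.pi fun l => fderiv ℝ (fun x => U x l) x :=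
      fderiv_pi fun l => hdiff l x
    rw [h2, ContinuousLinearMap.pi_apply, hfd]
  rw [divergence_eq_sum_inner_fderiv (EuclideanSpace.basisFun ι ℝ)]
  have hterm : ∀ l, ⟪(EuclideanSpace.basisFun ι ℝ) l,
      fderiv ℝ (fun x => reVec fun l => 𝓕 (fun ξ => b ξ l) x) x ((EuclideanSpace.basisFun ι ℝ) l)⟫ =
      (𝓕 (fun ξ => (-(2 * π * I) * ((ξ l : ℝ) : ℂ)) * b ξ l) x).re := by
    intro l
    rw [EuclideanSpace.basisFun_apply, EuclideanSpace.inner_single_left, hfderiv]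
    simp only [conj_trivial, one_mul, EuclideanSpace.inner_single_right]
  simp_rw [hterm]
  rw [← Complex.re_sum]
  have hint : ∀ l ∈ (Finset.univ : Finset ι), Integrable fun ξ : EuclideanSpace ℝ ι =>
      (-(2 * π * I) * ((ξ l : ℝ) : ℂ)) * b ξ l := fun l _ =>
    integrable_twoPiI_coord_mul (hb l).1 (by simpa using hb1 l) l
  rw [← fourier_finset_sum' Finset.univ hint]

/-- The divergence symbol `Σₗ -2πi ξₗ bₗ` of a conjugation-symmetric coefficient is conjugation
symmetric. [folklore] -/
theorem divSymbol_conj_symm (hbc : ∀ ξ l, b (-ξ) l = conj (b ξ l)) (ξ : EuclideanSpace ℝ ι) :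
    (∑ l, (-(2 * π * I) * (((-ξ) l : ℝ) : ℂ)) * b (-ξ) l) = conj (∑ l, (-(2 * π * I) * ((ξ l : ℝ) : ℂ)) * b ξ l) := by
  rw [map_sum]
  refine Finset.sum_congr rfl fun l _ => ?_
  simp only [PiLp.neg_apply, Complex.ofReal_neg, map_mul, map_neg, Complex.conj_ofReal, hbc, Complex.conj_I, map_ofNat]
  ring

/-- **Transversality almost everywhere from incompressibility of the synthesis.** Let `b` be a
measurable, conjugation-symmetric coefficient with integrable components, integrable first
moments and square-integrable coordinate-weighted components, whose real synthesis
`v = Re 𝓕 b` is divergence free. Then `Σₗ ξₗ b(ξ)ₗ = 0` for a.e. `ξ`: the divergence symbol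
`W = Σₗ -2πi ξₗ bₗ ∈ L¹ ∩ L²` has real synthesis `𝓕 W = div v = 0`, so `‖W‖_{L²} = ‖𝓕 W‖_{L²} = 0`
by Plancherel. [folklore] -/
theorem ae_transversal_of_isDivFree [DecidableEq ι] (hb : ∀ l, Integrable (fun ξ => b ξ l) volume)
    (hb1 : ∀ l, Integrable (fun ξ : EuclideanSpace ℝ ι => ‖ξ‖ * ‖b ξ l‖) volume)
    (hb2 : ∀ l, MemLp (fun ξ : EuclideanSpace ℝ ι => ((ξ l : ℝ) : ℂ) * b ξ l) 2 volume)
    (hbc : ∀ ξ l, b (-ξ) l = conj (b ξ l))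
    (hdiv : VectorCalculus.IsDivFree fun x => reVec fun l => 𝓕 (fun ξ => b ξ l) x) :
    ∀ᵐ ξ : EuclideanSpace ℝ ι ∂volume, ∑ l, ((ξ l : ℝ) : ℂ) * b ξ l = 0 := by
  set W : EuclideanSpace ℝ ι → ℂ := fun ξ => ∑ l, (-(2 * π * I) * ((ξ l : ℝ) : ℂ)) * b ξ l with hW
  have hWi : Integrable W volume :=
    integrable_finsetSum _ fun l _ => integrable_twoPiI_coord_mul (hb l).1 (by simpa using hb1 l) l
  have hW2 : MemLp W 2 volume := by
    refine memLp_finsetSum Finset.univ fun l _ => ?_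
    have h := (hb2 l).const_mul (-(2 * π * I))
    refine MemLp.ae_eq (Eventually.of_forall fun ξ => ?_) h
    show -(2 * π * I) * (((ξ l : ℝ) : ℂ) * b ξ l) = (-(2 * π * I) * ((ξ l : ℝ) : ℂ)) * b ξ l
    ring
  -- `𝓕 W = 0`
  have hFW : ∀ x, 𝓕 W x = 0 := by
    intro x
    have hre : (𝓕 W x).re = 0 := by
      rw [← divergence_reVec_fourier hb hb1 x]
      exact hdiv x
    have hsymm : ∀ ξ, W (-ξ) = conj (W ξ) := fun ξ => divSymbol_conj_symm hbc ξ
    rw [fourier_eq_re_of_conj_symm hsymm x, hre, Complex.ofReal_zero]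
  -- Plancherel
  have hnorm : eLpNorm W 2 volume = 0 := by
    rw [← eLpNorm_fourierIntegral_eq hWi hW2]
    have : (𝓕 W : EuclideanSpace ℝ ι → ℂ) = 0 := funext hFW
    rw [this, eLpNorm_zero]
  have hae : W =ᵐ[volume] 0 := (eLpNorm_eq_zero_iff hW2.1 two_ne_zero).1 hnorm
  filter_upwards [hae] with ξ hξ
  have hξ' : -(2 * π * I) * ∑ l, ((ξ l : ℝ) : ℂ) * b ξ l = 0 := by
    rw [Finset.mul_sum]
    have : ∑ l, -(2 * π * I) * (((ξ l : ℝ) : ℂ) * b ξ l) = W ξ := by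
      simp only [hW]
      refine Finset.sum_congr rfl fun l _ => ?_
      ring
    rw [this]
    exact hξ
  have hc : -(2 * (π : ℂ) * I) ≠ 0 := by
    simp [Real.pi_ne_zero, Complex.I_ne_zero]
  exact (mul_eq_zero.1 hξ').resolve_left hc

end Transversal

/-! ### The pointwise Leray projection of coefficient vectors -/

/-!
The **pointwise Leray projection** of a complex coefficient vector onto `ξ^⊥` is
`P_ξ c = c − (Σₖ ξₖ cₖ / ‖ξ‖²) ξ` (`P_0 = id` with Lean's `x / 0 = 0`). As for the symmetrisation,
the operation enters the lemmas below through the hypothesis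
`hP : ∀ ξ c l, P ξ c l = c l - (Σₖ ξₖ cₖ) / ‖ξ‖² * ξₗ` on a map `P`.
-/

section Proj

variable {P : EuclideanSpace ℝ ι → (ι → ℂ) → ι → ℂ}

/-- **Transversality of the projection**: `Σₗ ξₗ (P_ξ c)ₗ = 0`. [folklore] -/
theorem sum_mul_projC (hP : ∀ ξ c l, P ξ c l = c l - (∑ k, ((ξ k : ℝ) : ℂ) * c k) / ((‖ξ‖ ^ 2 : ℝ) : ℂ) * ((ξ l : ℝ) : ℂ))
    (ξ : EuclideanSpace ℝ ι) (c : ι → ℂ) : ∑ l, ((ξ l : ℝ) : ℂ) * P ξ c l = 0 := by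
  simp only [hP, mul_sub, Finset.sum_sub_distrib]
  set X : ℂ := (∑ k, ((ξ k : ℝ) : ℂ) * c k) / ((‖ξ‖ ^ 2 : ℝ) : ℂ) with hX
  have hsq : ∑ l, ((ξ l : ℝ) : ℂ) * (X * ((ξ l : ℝ) : ℂ)) = X * ((‖ξ‖ ^ 2 : ℝ) : ℂ) := by
    rw [← sum_sq_eq_norm_sq ξ, Complex.ofReal_sum, Finset.mul_sum]
    refine Finset.sum_congr rfl fun l _ => ?_
    push_cast
    ring
  rw [hsq, hX]
  by_cases h0 : ((‖ξ‖ ^ 2 : ℝ) : ℂ) = 0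
  · -- `ξ = 0`
    have hn : ‖ξ‖ = 0 := by
      have : (‖ξ‖ ^ 2 : ℝ) = 0 := by exact_mod_cast h0
      exact pow_eq_zero_iff (n := 2) two_ne_zero |>.1 this
    have hξ : ξ = 0 := norm_eq_zero.1 hn
    simp [hξ]
  · rw [div_mul_cancel₀ _ h0, sub_self]

/-- The projection is the identity on transversal vectors. [folklore] -/
theorem projC_eq_self (hP : ∀ ξ c l, P ξ c l = c l - (∑ k, ((ξ k : ℝ) : ℂ) * c k) / ((‖ξ‖ ^ 2 : ℝ) : ℂ) * ((ξ l : ℝ) : ℂ))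
    {ξ : EuclideanSpace ℝ ι} {c : ι → ℂ} (h : ∑ k, ((ξ k : ℝ) : ℂ) * c k = 0) : P ξ c = c := by
  funext l
  rw [hP, h, zero_div, zero_mul, sub_zero]

/-- **The projection commutes with conjugation-reflection**: `P_{-ξ} (conj c) = conj (P_ξ c)`. [folklore] -/
theorem projC_neg_conj (hP : ∀ ξ c l, P ξ c l = c l - (∑ k, ((ξ k : ℝ) : ℂ) * c k) / ((‖ξ‖ ^ 2 : ℝ) : ℂ) * ((ξ l : ℝ) : ℂ))
    (ξ : EuclideanSpace ℝ ι) (c : ι → ℂ) (l : ι) :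
    P (-ξ) (fun k => conj (c k)) l = conj (P ξ c l) := by
  simp only [hP, PiLp.neg_apply, Complex.ofReal_neg, norm_neg, map_sub, map_mul, map_div₀, map_sum,
    Complex.conj_ofReal, neg_mul, mul_neg, Finset.sum_neg_distrib, neg_neg, neg_div]

/-- **The projection is bounded**: `‖P_ξ c‖ ≤ (1 + card ι) ‖c‖`. [folklore] -/
theorem norm_projC_le (hP : ∀ ξ c l, P ξ c l = c l - (∑ k, ((ξ k : ℝ) : ℂ) * c k) / ((‖ξ‖ ^ 2 : ℝ) : ℂ) * ((ξ l : ℝ) : ℂ))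
    (ξ : EuclideanSpace ℝ ι) (c : ι → ℂ) : ‖P ξ c‖ ≤ (1 + Fintype.card ι) * ‖c‖ := by
  have hS : ‖∑ k, ((ξ k : ℝ) : ℂ) * c k‖ ≤ Fintype.card ι * (‖ξ‖ * ‖c‖) := by
    calc ‖∑ k, ((ξ k : ℝ) : ℂ) * c k‖ ≤ ∑ k, ‖((ξ k : ℝ) : ℂ) * c k‖ := norm_sum_le _ _
      _ ≤ ∑ _k : ι, ‖ξ‖ * ‖c‖ := Finset.sum_le_sum fun k _ => by
          rw [norm_mul, Complex.norm_real, Real.norm_eq_abs]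
          exact mul_le_mul (abs_apply_le_norm ξ k) (norm_le_pi_norm c k) (norm_nonneg _) (norm_nonneg _)
      _ = Fintype.card ι * (‖ξ‖ * ‖c‖) := by rw [Finset.sum_const, Finset.card_univ, nsmul_eq_mul]
  have hcorr : ∀ l, ‖(∑ k, ((ξ k : ℝ) : ℂ) * c k) / ((‖ξ‖ ^ 2 : ℝ) : ℂ) * ((ξ l : ℝ) : ℂ)‖ ≤ Fintype.card ι * ‖c‖ := by
    intro l
    by_cases hξ : ‖ξ‖ = 0
    · have : ξ = 0 := norm_eq_zero.1 hξ
      simp [this]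
      positivity
    · have hpos : 0 < ‖ξ‖ := lt_of_le_of_ne (norm_nonneg _) (Ne.symm hξ)
      rw [norm_mul, norm_div, Complex.norm_real, Complex.norm_real, Real.norm_of_nonneg (by positivity),
        Real.norm_eq_abs]
      calc ‖∑ k, ((ξ k : ℝ) : ℂ) * c k‖ / ‖ξ‖ ^ 2 * |ξ l| ≤ Fintype.card ι * (‖ξ‖ * ‖c‖) / ‖ξ‖ ^ 2 * ‖ξ‖ := by
            gcongr
            exact abs_apply_le_norm ξ l
        _ = Fintype.card ι * ‖c‖ := by field_simp
  refine (pi_norm_le_iff_of_nonneg (by positivity)).2 fun l => ?_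
  rw [hP]
  calc ‖c l - (∑ k, ((ξ k : ℝ) : ℂ) * c k) / ((‖ξ‖ ^ 2 : ℝ) : ℂ) * ((ξ l : ℝ) : ℂ)‖
      ≤ ‖c l‖ + ‖(∑ k, ((ξ k : ℝ) : ℂ) * c k) / ((‖ξ‖ ^ 2 : ℝ) : ℂ) * ((ξ l : ℝ) : ℂ)‖ := norm_sub_le _ _
    _ ≤ ‖c‖ + Fintype.card ι * ‖c‖ := add_le_add (norm_le_pi_norm c l) (hcorr l)
    _ = (1 + Fintype.card ι) * ‖c‖ := by ring

/-- The projection of a measurable coefficient field is measurable. [folklore] -/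
theorem measurable_projC (hP : ∀ ξ c l, P ξ c l = c l - (∑ k, ((ξ k : ℝ) : ℂ) * c k) / ((‖ξ‖ ^ 2 : ℝ) : ℂ) * ((ξ l : ℝ) : ℂ))
    {b : EuclideanSpace ℝ ι → ι → ℂ} (hb : Measurable b) : Measurable fun ξ => P ξ (b ξ) := by
  refine measurable_pi_iff.2 fun l => ?_
  have hc : ∀ k, Measurable fun ξ : EuclideanSpace ℝ ι => ((ξ k : ℝ) : ℂ) := fun k =>
    (Complex.continuous_ofReal.comp (by fun_prop : Continuous fun ξ : EuclideanSpace ℝ ι => ξ k)).measurable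
  have hS : Measurable fun ξ : EuclideanSpace ℝ ι => ∑ k, ((ξ k : ℝ) : ℂ) * b ξ k :=
    Finset.measurable_sum _ fun k _ => (hc k).mul (measurable_pi_iff.1 hb k)
  have hn : Measurable fun ξ : EuclideanSpace ℝ ι => ((‖ξ‖ ^ 2 : ℝ) : ℂ) :=
    (Complex.continuous_ofReal.comp (by fun_prop : Continuous fun ξ : EuclideanSpace ℝ ι => ‖ξ‖ ^ 2)).measurable
  simp only [hP]
  exact (measurable_pi_iff.1 hb l).sub ((hS.div hn).mul (hc l))

/-- Weighted `L²` norms of the projected field are controlled by those of the field. [folklore] -/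
theorem eLpNorm_wfun_projC_le (hP : ∀ ξ c l, P ξ c l = c l - (∑ k, ((ξ k : ℝ) : ℂ) * c k) / ((‖ξ‖ ^ 2 : ℝ) : ℂ) * ((ξ l : ℝ) : ℂ))
    (b : EuclideanSpace ℝ ι → ι → ℂ) (K : ℕ) :
    eLpNorm (wfun K fun ξ => P ξ (b ξ)) 2 (volume : Measure (EuclideanSpace ℝ ι)) ≤
      ENNReal.ofReal (1 + Fintype.card ι) * eLpNorm (wfun K b) 2 volume := by
  refine eLpNorm_le_mul_eLpNorm_of_ae_le_mul (Eventually.of_forall fun ξ => ?_) 2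
  · rw [norm_wfun, norm_wfun]
    calc (1 + ‖ξ‖) ^ K * ‖P ξ (b ξ)‖ ≤ (1 + ‖ξ‖) ^ K * ((1 + Fintype.card ι) * ‖b ξ‖) :=
          mul_le_mul_of_nonneg_left (norm_projC_le hP ξ (b ξ)) (by positivity)
      _ = (1 + Fintype.card ι) * ((1 + ‖ξ‖) ^ K * ‖b ξ‖) := by ring

end Proj

/-! ### The Fourier datum of an `L²` divergence-free field -/

section Datum

/-- Components of an `L²` field, complexified, are in `L²`. [folklore] -/
theorem memLp_ofReal_apply {u₀ : EuclideanSpace ℝ ι → EuclideanSpace ℝ ι} (hu₀ : MemLp u₀ 2 volume) (l : ι) :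
    MemLp (fun x => ((u₀ x l : ℝ) : ℂ)) 2 (volume : Measure (EuclideanSpace ℝ ι)) := by
  refine hu₀.of_le ?_ (Eventually.of_forall fun x => ?_)
  · have hc : Continuous fun v : EuclideanSpace ℝ ι => ((v l : ℝ) : ℂ) :=
      Complex.continuous_ofReal.comp (EuclideanSpace.proj (𝕜 := ℝ) l).continuous
    exact hc.comp_aestronglyMeasurable hu₀.1
  · rw [Complex.norm_real, Real.norm_eq_abs]
    exact abs_apply_le_norm (u₀ x) l

/-- **The mollified field from the `L²` Fourier transform of its components.** For `u₀ ∈ L²` and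
a component `l`, let `g = 𝓕⁻ u₀ₗ ∈ L²` (Mathlib's `L²` inverse transform); then for every `x`,
`𝓕 (m · g)(x) = (J_χ u₀)(x)ₗ` (`fourier_msymbol_mul_Lp`, `𝓕 𝓕⁻ = id` on `L²`, and
`θ ⋆ u₀ₗ = (J_χ u₀)ₗ`). [folklore] -/
theorem fourier_msymbol_mul_fourierInv {u₀ : EuclideanSpace ℝ ι → EuclideanSpace ℝ ι} (hu₀ : MemLp u₀ 2 volume) (l : ι)
    (x : EuclideanSpace ℝ ι) :
    𝓕 (fun ξ => (msymbol χ ξ : ℂ) *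
        ((𝓕⁻ ((memLp_ofReal_apply hu₀ l).toLp _) : Lp ℂ 2 (volume : Measure (EuclideanSpace ℝ ι))) :
          EuclideanSpace ℝ ι → ℂ) ξ) x = ((mollify χ u₀ x l : ℝ) : ℂ) := by
  set f : Lp ℂ 2 (volume : Measure (EuclideanSpace ℝ ι)) := (memLp_ofReal_apply hu₀ l).toLp _ with hf
  rw [fourier_msymbol_mul_Lp χ (𝓕⁻ f) x, fourier_fourierInv_eq]
  have hfae : (f : EuclideanSpace ℝ ι → ℂ) =ᵐ[volume] fun y => ((u₀ y l : ℝ) : ℂ) := (memLp_ofReal_apply hu₀ l).coeFn_toLp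
  have h1 : ∫ y, bumpC χ (x - y) * (f : EuclideanSpace ℝ ι → ℂ) y = ∫ y, bumpC χ (x - y) * ((u₀ y l : ℝ) : ℂ) := by
    refine integral_congr_ae ?_
    filter_upwards [hfae] with y hy
    rw [hy]
  rw [h1]
  have h2 : ∫ y, bumpC χ (x - y) * ((u₀ y l : ℝ) : ℂ) = ∫ y, bumpC χ y * ((u₀ (x - y) l : ℝ) : ℂ) := by
    rw [← integral_sub_left_eq_self (fun y => bumpC χ y * ((u₀ (x - y) l : ℝ) : ℂ)) volume x]
    refine integral_congr_ae (Eventually.of_forall fun y => ?_)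
    simp only [sub_sub_cancel]
  rw [h2, mollify_apply_coord χ (hu₀.locallyIntegrable one_le_two) x l, ← integral_complex_ofReal]
  refine integral_congr_ae (Eventually.of_forall fun y => ?_)
  simp only [bumpC]
  push_cast
  ring

/-- **The Fourier datum of the regularised problem** (Leray 1934, Ch. V §26: the datum
`\overline{U(x,0)}` of the regularised system is the mollification of the given square-summable,
quasi-divergence-free initial state; Ożański–Pooley 2018, Thm. 6.33 as used in the proof of
Thm. 6.37 with `u_ε(0) = J_ε u₀`). Let `u₀ ∈ L²(E)` be weakly divergence free and `χ` a bump kernel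
with multiplier `m = 𝓕θ`. There is a Fourier coefficient field `a` satisfying the hypotheses of the
global construction `GlobalHyp c m K a` of `NSRegFourierGlobal` — measurable, in every weighted
`L²`, transversal (`Σ ξₗ aₗ(ξ) = 0`) and conjugation symmetric at every frequency — whose
synthesis is the mollified datum: `𝓕 aₗ = (J_χ u₀)ₗ`. Construction: `a = P_ξ (m · (𝓕⁻u₀)ˢ)` with
Mathlib's `L²` Fourier transform, the pointwise symmetrisation `ˢ` (a null modification, by the
reality of `J_χ u₀`) and the pointwise Leray projection `P_ξ` (a null modification, since
`div J_χ u₀ = 0` forces transversality a.e. by Plancherel). [cite: Leray1934, Ch. V §26 (5.1)] -/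
theorem exists_fourierDatum [DecidableEq ι] {u₀ : EuclideanSpace ℝ ι → EuclideanSpace ℝ ι} (hu₀ : MemLp u₀ 2 volume)
    (hdiv : IsWeaklyDivFree u₀) {c : ℝ} (hc : 0 < c) {K : ℕ} (hK : Fintype.card ι < 2 * K) :
    ∃ a : EuclideanSpace ℝ ι → ι → ℂ, GlobalHyp c (msymbol χ) K a ∧
      (∀ K' : ℕ, eLpNorm (wfun K' a) 2 volume < ⊤) ∧
      ∀ (x : EuclideanSpace ℝ ι) (l : ι), 𝓕 (fun ξ => a ξ l) x = ((mollify χ u₀ x l : ℝ) : ℂ) := by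
  -- the `L²` representatives `ĝₗ` of `𝓕⁻ u₀ₗ` and their symmetrisations
  set g : ι → EuclideanSpace ℝ ι → ℂ := fun l =>
    ((𝓕⁻ ((memLp_ofReal_apply hu₀ l).toLp _) : Lp ℂ 2 (volume : Measure (EuclideanSpace ℝ ι))) :
      EuclideanSpace ℝ ι → ℂ) with hg
  have hgm : ∀ l, Measurable (g l) := fun l => (Lp.stronglyMeasurable _).measurable
  have hg2 : ∀ l, MemLp (g l) 2 (volume : Measure (EuclideanSpace ℝ ι)) := fun l => Lp.memLp _
  have hkey : ∀ x l, 𝓕 (fun ξ => (msymbol χ ξ : ℂ) * g l ξ) x = ((mollify χ u₀ x l : ℝ) : ℂ) :=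
    fun x l => fourier_msymbol_mul_fourierInv χ hu₀ l x
  set S : (EuclideanSpace ℝ ι → ℂ) → EuclideanSpace ℝ ι → ℂ := fun g ξ => 2⁻¹ * (g ξ + conj (g (-ξ))) with hSdef
  have hS : ∀ g ξ, S g ξ = 2⁻¹ * (g ξ + conj (g (-ξ))) := fun _ _ => rfl
  set P : EuclideanSpace ℝ ι → (ι → ℂ) → ι → ℂ := fun ξ c l =>
    c l - (∑ k, ((ξ k : ℝ) : ℂ) * c k) / ((‖ξ‖ ^ 2 : ℝ) : ℂ) * ((ξ l : ℝ) : ℂ) with hPdef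
  have hP : ∀ ξ c l, P ξ c l = c l - (∑ k, ((ξ k : ℝ) : ℂ) * c k) / ((‖ξ‖ ^ 2 : ℝ) : ℂ) * ((ξ l : ℝ) : ℂ) :=
    fun _ _ _ => rfl
  set G : EuclideanSpace ℝ ι → ι → ℂ := fun ξ l => S (g l) ξ with hG
  have hGm : Measurable G := measurable_pi_iff.2 fun l => measurable_symRep hS (hgm l)
  have hG2 : ∀ l, MemLp (fun ξ => G ξ l) 2 (volume : Measure (EuclideanSpace ℝ ι)) := fun l => memLp_symRep hS (hg2 l)
  -- the raw (symmetrised) datum `a₁ = m G`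
  set a₁ : EuclideanSpace ℝ ι → ι → ℂ := fun ξ l => (msymbol χ ξ : ℂ) * G ξ l with ha₁
  have ha₁m : Measurable a₁ :=
    measurable_pi_iff.2 fun l => (continuous_msymbol χ).measurable.complex_ofReal.mul (measurable_pi_iff.1 hGm l)
  have ha₁F : ∀ x l, 𝓕 (fun ξ => a₁ ξ l) x = ((mollify χ u₀ x l : ℝ) : ℂ) := by
    intro x l
    have hreal : conj (𝓕 (fun ξ => (msymbol χ ξ : ℂ) * g l ξ) x) = 𝓕 (fun ξ => (msymbol χ ξ : ℂ) * g l ξ) x := by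
      rw [hkey, Complex.conj_ofReal]
    have := fourier_msymbol_mul_symRep χ hS (hg2 l) x hreal
    rw [hkey] at this
    exact this
  have ha₁c : ∀ ξ l, a₁ (-ξ) l = conj (a₁ ξ l) := by
    intro ξ l
    simp only [ha₁, hG, symRep_neg hS, map_mul, Complex.conj_ofReal, msymbol_neg]
  have ha₁i : ∀ l, Integrable (fun ξ => a₁ ξ l) volume := fun l => integrable_msymbol_mul χ hG2 l
  have ha₁1 : ∀ l, Integrable (fun ξ : EuclideanSpace ℝ ι => ‖ξ‖ * ‖a₁ ξ l‖) volume := fun l =>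
    integrable_norm_mul_msymbol_mul χ hG2 l
  have ha₁2 : ∀ l, MemLp (fun ξ : EuclideanSpace ℝ ι => ((ξ l : ℝ) : ℂ) * a₁ ξ l) 2 volume := fun l =>
    memLp_coord_mul_msymbol_mul χ hG2 hGm l l
  have ha₁w : ∀ K' : ℕ, eLpNorm (wfun K' a₁) 2 (volume : Measure (EuclideanSpace ℝ ι)) < ⊤ := fun K' =>
    eLpNorm_wfun_msymbol_mul_lt_top χ hG2 hGm K'
  -- the synthesis of `a₁` is the mollified datum, which is divergence free
  have hul : LocallyIntegrable u₀ volume := hu₀.locallyIntegrable one_le_two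
  have hsyn : (fun x => reVec fun l => 𝓕 (fun ξ => a₁ ξ l) x) = mollify χ u₀ := by
    funext x
    ext l
    rw [reVec_apply, ha₁F, Complex.ofReal_re]
  have hdiv₁ : VectorCalculus.IsDivFree fun x => reVec fun l => 𝓕 (fun ξ => a₁ ξ l) x := by
    rw [hsyn]
    intro x
    exact divergence_convolution_eq_zero χ.contDiff_normed χ.hasCompactSupport_normed hul hdiv x
  have htrans : ∀ᵐ ξ : EuclideanSpace ℝ ι ∂volume, ∑ l, ((ξ l : ℝ) : ℂ) * a₁ ξ l = 0 :=
    ae_transversal_of_isDivFree ha₁i ha₁1 ha₁2 ha₁c hdiv₁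
  -- the datum: pointwise Leray projection of `a₁`
  refine ⟨fun ξ => P ξ (a₁ ξ), ?_, ?_, ?_⟩
  · -- `GlobalHyp`
    have hw : ∀ K' : ℕ, eLpNorm (wfun K' fun ξ => P ξ (a₁ ξ)) 2 (volume : Measure (EuclideanSpace ℝ ι)) < ⊤ :=
      fun K' => lt_of_le_of_lt (eLpNorm_wfun_projC_le hP a₁ K')
        (ENNReal.mul_lt_top ENNReal.ofReal_lt_top (ha₁w K'))
    refine ⟨hc, isMollifierSymbol_msymbol χ, hK, measurable_projC hP ha₁m, ?_, hw K, fun ξ => sum_mul_projC hP ξ (a₁ ξ), ?_⟩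
    · have := hw 0
      rwa [wfun_zero] at this
    · intro ξ l
      have hneg : a₁ (-ξ) = fun k => conj (a₁ ξ k) := funext fun k => ha₁c ξ k
      show P (-ξ) (a₁ (-ξ)) l = conj (P ξ (a₁ ξ) l)
      rw [hneg, projC_neg_conj hP]
  · intro K'
    exact lt_of_le_of_lt (eLpNorm_wfun_projC_le hP a₁ K') (ENNReal.mul_lt_top ENNReal.ofReal_lt_top (ha₁w K'))
  · intro x l
    rw [← ha₁F x l]
    refine Real.fourier_congr_ae ?_ x
    filter_upwards [htrans] with ξ hξ
    show P ξ (a₁ ξ) l = a₁ ξ l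
    rw [projC_eq_self hP hξ]

end Datum

end Literature.Analysis.FluidPDE.FourierNS

end
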